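import Mathlib
import Summits.Ventures.FusionMHD.Models.TearingFRS1M4Jets3
import Summits.Ventures.FusionMHD.Models.TearingFRS1Matching
import Literature.Analysis.ODE.LinearSecondOrder
import HarnessLib

/-!
# F3.r3 instance «TearingFRS1.M4» ((4,2) harmonic, printed `q₀ = 7/5`), steps (5)–(7): matching an outer solution to the Frobenius
# patch gives `Δ′`

The `m = 4` copy of `TearingFRS1Matching.lean` (model-6 g5; models/F3-SCOPING.md §7f). MODEL M₄: the scaled marginal
tearing equation `M4.IsScaledOuterSolution` (`ψ_uu + ψ_u/u − 16ψ/u² − 560ψ/((7+3u²)²(u²−1)) = 0`). Identical in structure to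
the `(2,1)` file; what changes is the coefficient `𝔮 = 16/(1+x)² + …` (`modelQ`; `𝔭 = modelP` and `model_denoms_ne_zero`,
`cramer_normalise` are the parent's, reused) and the local `q`-data (`M4.qc`, hence the patch pair
`scalarSmallSol pc M4.qc`, `scalarLogSol pc M4.qc 1 (14/5) log`):

* `outer_shift`, `patch_combination`, `repr_of_match` (uniqueness, `Literature.Analysis.ODE.eqOn_of_solution_Ioo`);
* `SmallPatchOn`, `LogPatchOn` (hypothesis bundles) with **`smallPatchOn_three_tenths`, `logPatchOn_three_tenths`** supplied
  by `TearingFRS1M4Jets3.lean` (patch certified on `|x| < 3/10`);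
* **`isDeltaPrime_of_matching`** — if `L(1 − x₀) = ψ_L(−x₀) + b_L ψ_s(−x₀)` and `R(1 + x₀) = ψ_L(x₀) + b_R ψ_s(x₀)` (with
  derivatives), the glued `ψ = L ∪ {ψ(1) = 1} ∪ R` has `Tearing.IsDeltaPrime ψ ψ′ 1 (b_R − b_L)` [Miyamoto2007 §9.1
  (9.16); Schnack2009 (34.13)] — by `Tearing.isDeltaPrime_of_logBranch` with `A = 1`, `κ = 14/5`.

CERTIFIED here: the implication only. VALIDATED (float preview): `r_s Δ′_{4,2} ≈ −4.394`. MODELLED: model M₄ = row #13's printed profile, mode (4,2) (MV-7R). [instance data]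
-/

noncomputable section

open Set Filter Literature.Analysis.ODE Literature.MathematicalPhysics.MHD
open scoped Topology

namespace Summit.Ventures.FusionMHD.Models

namespace TearingFRS1

namespace M4

/-! ### The model coefficients in the local variable `x = u − 1` -/

/-- `𝔮(x) = 16/(1+x)² + 560/((7 + 3(1+x)²)² ((1+x)² − 1))` (`m = 4`): the coefficient of `y` in the outer equation at
`u = 1 + x`. [instance data] -/
def modelQ (x : ℝ) : ℝ := 16 / (1 + x) ^ 2 + 560 / ((7 + 3 * (1 + x) ^ 2) ^ 2 * ((1 + x) ^ 2 - 1))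

/-- `𝔮` is continuous on every set avoiding `x ∈ {0, −1, −2}`. [instance data] -/
theorem continuousOn_modelQ {s : Set ℝ} (hs : ∀ x ∈ s, x ≠ 0 ∧ -1 < x ∧ x < 1) : ContinuousOn modelQ s := by
  refine ContinuousOn.add ?_ ?_
  · refine ContinuousOn.div continuousOn_const (by fun_prop) fun x hx => ?_
    exact pow_ne_zero 2 (model_denoms_ne_zero (hs x hx).1 (hs x hx).2.1 (hs x hx).2.2).1
  · refine ContinuousOn.div continuousOn_const (by fun_prop) fun x hx => ?_
    obtain ⟨-, -, h7, hu⟩ := model_denoms_ne_zero (hs x hx).1 (hs x hx).2.1 (hs x hx).2.2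
    exact mul_ne_zero (pow_ne_zero 2 h7) hu

/-- The local normal form solved for the second derivative: for `x ∉ {0, −1, −2}`,
`x D + p(x) y′ + q(x) y = 0 ↔ D = 𝔭(x) y′ + 𝔮(x) y`. [instance data] -/
theorem normal_form_iff_model {x y₀ y₁ D : ℝ} (hx0 : x ≠ 0) (hx1 : 1 + x ≠ 0) (hx2 : x + 2 ≠ 0) :
    x * D + p x * y₁ + q x * y₀ = 0 ↔ D = modelP x * y₁ + modelQ x * y₀ := by
  rw [local_normal_form hx0 hx1 hx2, modelP, modelQ]
  constructor <;> intro h <;> rw [h] <;> ring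

/-! ### Outer solutions in the local variable -/

/-- An outer solution of MODEL M on a set `s` of radii, read in `x = u − 1`, solves `y″ = 𝔭 y′ + 𝔮 y` on the shifted
set. [instance data] -/
theorem outer_shift {L L' : ℝ → ℝ} {s : Set ℝ} (hL : M4.IsScaledOuterSolution L L' s) {x : ℝ} (hx : 1 + x ∈ s) :
    HasDerivAt (fun z => L (1 + z)) (L' (1 + x)) x ∧
      HasDerivAt (fun z => L' (1 + z)) (modelP x * L' (1 + x) + modelQ x * L (1 + x)) x := by
  obtain ⟨h1, h2⟩ := hL (1 + x) hx
  refine ⟨h1.comp_const_add 1 x, ?_⟩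
  refine (h2.comp_const_add 1 x).congr_deriv ?_
  rw [modelP, modelQ]
  ring

/-! ### The patch pair solves the same linear equation -/

section Patch

-- Names used in the docstrings: the small pair `S = (ψ_s, ψ_s′) = scalarSmallSol pc M4.qc`, the large pair
-- `Lg = (ψ_L, ψ_L′) = scalarLogSol pc M4.qc 1 (14/5) Real.log`, the regular part `E = (η, ζ) = scalarLogRegSol pc M4.qc 1 (14/5)`.

/-- The PATCH FACTS on a radius `δ` (small solution) — hypothesis bundle of this instance (predicate in `δ`), the
`m = 4` copy of `TearingFRS1.SmallPatchOn` (different `qc`). [instance data] -/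
def SmallPatchOn (δ : ℝ) : Prop :=
  ∀ x : ℝ, |x| < δ →
    DifferentiableAt ℝ (scalarSmallSol pc M4.qc) x ∧
      (x ≠ 0 → HasDerivAt (fun z => ((scalarSmallSol pc M4.qc) z).1) (((scalarSmallSol pc M4.qc) x).2) x) ∧
      HasDerivAt (fun z => ((scalarSmallSol pc M4.qc) z).2) ((deriv (scalarSmallSol pc M4.qc) x).2) x ∧
      x * (deriv (scalarSmallSol pc M4.qc) x).2 + p x * ((scalarSmallSol pc M4.qc) x).2 + q x * ((scalarSmallSol pc M4.qc) x).1 = 0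

/-- The PATCH FACTS on a radius `δ` (logarithmic solution) — hypothesis bundle of this instance (predicate in `δ`), the
`m = 4` copy of `TearingFRS1.LogPatchOn`. [instance data] -/
def LogPatchOn (δ : ℝ) : Prop :=
  ∀ x : ℝ, |x| < δ → x ≠ 0 →
    HasDerivAt (fun z => ((scalarLogSol pc M4.qc 1 (14 / 5) Real.log) z).1) (((scalarLogSol pc M4.qc 1 (14 / 5) Real.log) x).2) x ∧
      HasDerivAt (fun z => ((scalarLogSol pc M4.qc 1 (14 / 5) Real.log) z).2) ((deriv (scalarLogSol pc M4.qc 1 (14 / 5) Real.log) x).2) x ∧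
      x * (deriv (scalarLogSol pc M4.qc 1 (14 / 5) Real.log) x).2 + p x * ((scalarLogSol pc M4.qc 1 (14 / 5) Real.log) x).2 + q x * ((scalarLogSol pc M4.qc 1 (14 / 5) Real.log) x).1 = 0

/-- Monotonicity of the patch facts in the radius. [instance data] -/
theorem SmallPatchOn.mono {δ δ' : ℝ} (h : SmallPatchOn δ) (hle : δ' ≤ δ) : SmallPatchOn δ' :=
  fun x hx => h x (lt_of_lt_of_le hx hle)

/-- Monotonicity of the patch facts in the radius. [instance data] -/
theorem LogPatchOn.mono {δ δ' : ℝ} (h : LogPatchOn δ) (hle : δ' ≤ δ) : LogPatchOn δ' :=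
  fun x hx hx0 => h x (lt_of_lt_of_le hx hle) hx0

/-- **The small-solution patch facts on radius `3/10`.** [instance data] -/
theorem smallPatchOn_three_tenths : SmallPatchOn (3 / 10) :=
  fun _ hx => smallSol_on_wide (lt_of_lt_of_le hx (by norm_num))

/-- **The logarithmic-branch patch facts on radius `3/10`.** [instance data] -/
theorem logPatchOn_three_tenths : LogPatchOn (3 / 10) := fun _ hx hx0 => logSol_on_wide hx hx0

variable {δ : ℝ}

/-- Values at the surface: `(ψ_s, ψ_s′)(0) = (0, 1)`. [instance data] -/
theorem small_zero : (scalarSmallSol pc M4.qc) 0 = ((0 : ℝ), (1 : ℝ)) := isScalarLogData.smallSol.1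

/-- Values at the surface: `(η, ζ)(0) = (1, 14/5)`. [instance data] -/
theorem reg_zero : (scalarLogRegSol pc M4.qc 1 (14 / 5)) 0 = ((1 : ℝ), (14 / 5 : ℝ)) := (isScalarLogData.logRegSol 1 (14 / 5)).1

/-- `ψ_L = (14/5) log|x| ψ_s + η`. [instance data] -/
theorem log_fst (x : ℝ) : ((scalarLogSol pc M4.qc 1 (14 / 5) Real.log) x).1 = 14 / 5 * Real.log |x| * ((scalarSmallSol pc M4.qc) x).1 + ((scalarLogRegSol pc M4.qc 1 (14 / 5)) x).1 := by
  rw [scalarLogSol_fst, Real.log_abs, qc_val_0]; norm_num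

/-- `ψ_L′ = (14/5) log|x| ψ_s′ + ζ`. [instance data] -/
theorem log_snd (x : ℝ) : ((scalarLogSol pc M4.qc 1 (14 / 5) Real.log) x).2 = 14 / 5 * Real.log |x| * ((scalarSmallSol pc M4.qc) x).2 + ((scalarLogRegSol pc M4.qc 1 (14 / 5)) x).2 := by
  rw [scalarLogSol_snd, Real.log_abs, qc_val_0]; norm_num

/-- Every combination `ψ_L + b ψ_s` of the patch pair solves `y″ = 𝔭 y′ + 𝔮 y` at each `x` with `0 < |x| < δ`
(`δ ≤ 1/2`). [instance data] -/
theorem patch_combination (hδ : δ ≤ 1 / 2) (hS : SmallPatchOn δ) (hLg : LogPatchOn δ) (b : ℝ) {x : ℝ}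
    (hx : |x| < δ) (hx0 : x ≠ 0) :
    HasDerivAt (fun z => ((scalarLogSol pc M4.qc 1 (14 / 5) Real.log) z).1 + b * ((scalarSmallSol pc M4.qc) z).1) (((scalarLogSol pc M4.qc 1 (14 / 5) Real.log) x).2 + b * ((scalarSmallSol pc M4.qc) x).2) x ∧
      HasDerivAt (fun z => ((scalarLogSol pc M4.qc 1 (14 / 5) Real.log) z).2 + b * ((scalarSmallSol pc M4.qc) z).2)
        (modelP x * (((scalarLogSol pc M4.qc 1 (14 / 5) Real.log) x).2 + b * ((scalarSmallSol pc M4.qc) x).2) + modelQ x * (((scalarLogSol pc M4.qc 1 (14 / 5) Real.log) x).1 + b * ((scalarSmallSol pc M4.qc) x).1)) x := by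
  have hx' : -1 < x ∧ x < 1 := by constructor <;> cases abs_lt.1 hx <;> linarith
  obtain ⟨h1, h2, -, -⟩ := model_denoms_ne_zero hx0 hx'.1 hx'.2
  obtain ⟨-, hs1, hs2, hs3⟩ := hS x hx
  obtain ⟨hl1, hl2, hl3⟩ := hLg x hx hx0
  have es : (deriv (scalarSmallSol pc M4.qc) x).2 = modelP x * ((scalarSmallSol pc M4.qc) x).2 + modelQ x * ((scalarSmallSol pc M4.qc) x).1 :=
    (normal_form_iff_model hx0 h1 h2).1 hs3
  have el : (deriv (scalarLogSol pc M4.qc 1 (14 / 5) Real.log) x).2 = modelP x * ((scalarLogSol pc M4.qc 1 (14 / 5) Real.log) x).2 + modelQ x * ((scalarLogSol pc M4.qc 1 (14 / 5) Real.log) x).1 :=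
    (normal_form_iff_model hx0 h1 h2).1 hl3
  refine ⟨hl1.add ((hs1 hx0).const_mul b), ?_⟩
  refine (hl2.add (hs2.const_mul b)).congr_deriv ?_
  rw [es, el]
  ring

/-- **REPRESENTATION BY UNIQUENESS.** Let `(a, c)` be a punctured half-patch (`Ioo a c ⊆ {0 < |x| < δ}`, `δ ≤ 1/2`) and
`(F, F′)` a solution of `y″ = 𝔭 y′ + 𝔮 y` on it (e.g. an outer solution read in `x = u − 1`, `outer_shift`). If at ONE
point `t₀ ∈ (a, c)` the data of `F` equal those of `ψ_L + b ψ_s`, then `F = ψ_L + b ψ_s` and `F′ = ψ_L′ + b ψ_s′` on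
the whole of `(a, c)` (Grönwall uniqueness, `Literature.Analysis.ODE.eqOn_of_solution_Ioo`). [instance data] -/
theorem repr_of_match (hδ : δ ≤ 1 / 2) (hS : SmallPatchOn δ) (hLg : LogPatchOn δ) {a c t₀ : ℝ}
    (hac : ∀ x ∈ Ioo a c, |x| < δ ∧ x ≠ 0) (ht₀ : t₀ ∈ Ioo a c) {F F' : ℝ → ℝ}
    (hF : ∀ x ∈ Ioo a c, HasDerivAt F (F' x) x ∧ HasDerivAt F' (modelP x * F' x + modelQ x * F x) x) {b : ℝ}
    (h1 : F t₀ = ((scalarLogSol pc M4.qc 1 (14 / 5) Real.log) t₀).1 + b * ((scalarSmallSol pc M4.qc) t₀).1) (h2 : F' t₀ = ((scalarLogSol pc M4.qc 1 (14 / 5) Real.log) t₀).2 + b * ((scalarSmallSol pc M4.qc) t₀).2) :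
    ∀ x ∈ Ioo a c, F x = ((scalarLogSol pc M4.qc 1 (14 / 5) Real.log) x).1 + b * ((scalarSmallSol pc M4.qc) x).1 ∧ F' x = ((scalarLogSol pc M4.qc 1 (14 / 5) Real.log) x).2 + b * ((scalarSmallSol pc M4.qc) x).2 := by
  have hs' : ∀ x ∈ Ioo a c, x ≠ 0 ∧ -1 < x ∧ x < 1 := fun x hx => by
    obtain ⟨h, h0⟩ := hac x hx
    exact ⟨h0, by cases abs_lt.1 h; linarith, by cases abs_lt.1 h; linarith⟩
  have hP : ContinuousOn modelP (Ioo a c) := continuousOn_modelP fun x hx => by linarith [(hs' x hx).2.1]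
  have hQ : ContinuousOn modelQ (Ioo a c) := continuousOn_modelQ hs'
  have hG : ∀ x ∈ Ioo a c, HasDerivAt (fun z => ((scalarLogSol pc M4.qc 1 (14 / 5) Real.log) z).1 + b * ((scalarSmallSol pc M4.qc) z).1) (((scalarLogSol pc M4.qc 1 (14 / 5) Real.log) x).2 + b * ((scalarSmallSol pc M4.qc) x).2) x ∧
      HasDerivAt (fun z => ((scalarLogSol pc M4.qc 1 (14 / 5) Real.log) z).2 + b * ((scalarSmallSol pc M4.qc) z).2)
        (modelP x * (((scalarLogSol pc M4.qc 1 (14 / 5) Real.log) x).2 + b * ((scalarSmallSol pc M4.qc) x).2) + modelQ x * (((scalarLogSol pc M4.qc 1 (14 / 5) Real.log) x).1 + b * ((scalarSmallSol pc M4.qc) x).1)) x :=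
    fun x hx => patch_combination hδ hS hLg b (hac x hx).1 (hac x hx).2
  have key := eqOn_of_solution_Ioo (𝕜 := ℝ) hP hQ ht₀ hF hG h1 h2
  exact fun x hx => ⟨key.1 hx, key.2 hx⟩

/-! ### The matching theorem -/

/-- **MATCHING GIVES `Δ′` (steps (5)–(7) of the F3.r3 pipeline).** Let `0 < x₀ < δ ≤ 1/2` and let the patch facts hold
on radius `δ`. Let `L` be an outer solution of MODEL M on `(1 − δ, 1)` and `R` one on `(1, 1 + δ)`, NORMALISED so that
at the matching points their data are `ψ_L + b_L ψ_s` at `x = −x₀` resp. `ψ_L + b_R ψ_s` at `x = +x₀` (unit coefficient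
of the large solution — always reachable by scaling when the Wronskian of the outer solution with `ψ_s` is non-zero).
Let `ψ` be `L` on `(1 − δ, 1)`, `R` on `(1, 1 + δ)`, `ψ(1) = 1` (`= η(0)`), and `ψ′` be `L′`/`R′` accordingly. Then
`ψ` is continuous at the rational surface and the printed tearing index exists and equals `b_R − b_L`:
`Tearing.IsDeltaPrime ψ ψ′ 1 (b_R − b_L)` [Miyamoto2007 §9.1 (9.16)–(9.17); Schnack2009 (34.13)]. The dimensionless
`r_s Δ′_{2,1}` of MODEL M is this number when `L` is the axis-regular solution and `R` the wall solution. [instance data] -/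
theorem isDeltaPrime_of_matching {x₀ : ℝ} (hδ : δ ≤ 1 / 2) (hx₀ : 0 < x₀) (hx₀δ : x₀ < δ) (hS : SmallPatchOn δ)
    (hLg : LogPatchOn δ) {L L' R R' ψ ψ' : ℝ → ℝ} {bL bR : ℝ}
    (hL : IsScaledOuterSolution L L' (Ioo (1 - δ) 1)) (hR : IsScaledOuterSolution R R' (Ioo 1 (1 + δ)))
    (hLm : L (1 - x₀) = ((scalarLogSol pc M4.qc 1 (14 / 5) Real.log) (-x₀)).1 + bL * ((scalarSmallSol pc M4.qc) (-x₀)).1)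
    (hLm' : L' (1 - x₀) = ((scalarLogSol pc M4.qc 1 (14 / 5) Real.log) (-x₀)).2 + bL * ((scalarSmallSol pc M4.qc) (-x₀)).2)
    (hRm : R (1 + x₀) = ((scalarLogSol pc M4.qc 1 (14 / 5) Real.log) x₀).1 + bR * ((scalarSmallSol pc M4.qc) x₀).1) (hRm' : R' (1 + x₀) = ((scalarLogSol pc M4.qc 1 (14 / 5) Real.log) x₀).2 + bR * ((scalarSmallSol pc M4.qc) x₀).2)
    (hψl : ∀ u ∈ Ioo (1 - δ) 1, ψ u = L u ∧ ψ' u = L' u) (hψ1 : ψ 1 = 1)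
    (hψr : ∀ u ∈ Ioo 1 (1 + δ), ψ u = R u ∧ ψ' u = R' u) :
    Tearing.IsDeltaPrime ψ ψ' 1 (bR - bL) := by
  have hδ0 : 0 < δ := hx₀.trans hx₀δ
  -- the representations on the two punctured half-patches
  have hFl : ∀ x ∈ Ioo (-δ) 0, HasDerivAt (fun z => L (1 + z)) (L' (1 + x)) x ∧
      HasDerivAt (fun z => L' (1 + z)) (modelP x * L' (1 + x) + modelQ x * L (1 + x)) x :=
    fun x hx => outer_shift hL ⟨by linarith [hx.1], by linarith [hx.2]⟩
  have hFr : ∀ x ∈ Ioo 0 δ, HasDerivAt (fun z => R (1 + z)) (R' (1 + x)) x ∧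
      HasDerivAt (fun z => R' (1 + z)) (modelP x * R' (1 + x) + modelQ x * R (1 + x)) x :=
    fun x hx => outer_shift hR ⟨by linarith [hx.1], by linarith [hx.2]⟩
  have hacl : ∀ x ∈ Ioo (-δ) 0, |x| < δ ∧ x ≠ 0 := fun x hx => ⟨abs_lt.2 ⟨hx.1, by linarith [hx.2]⟩, hx.2.ne⟩
  have hacr : ∀ x ∈ Ioo 0 δ, |x| < δ ∧ x ≠ 0 := fun x hx => ⟨abs_lt.2 ⟨by linarith [hx.1], hx.2⟩, hx.1.ne'⟩
  have reprL := repr_of_match hδ hS hLg hacl (t₀ := -x₀) ⟨by linarith, by linarith⟩ hFl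
    (b := bL) (by simpa [sub_eq_add_neg] using hLm) (by simpa [sub_eq_add_neg] using hLm')
  have reprR := repr_of_match hδ hS hLg hacr (t₀ := x₀) ⟨hx₀, hx₀δ⟩ hFr (b := bR) hRm hRm'
  -- regularity of the patch data at the surface
  obtain ⟨hSd, -, -, -⟩ := hS 0 (by simpa using hδ0)
  have hEd : DifferentiableAt ℝ (scalarLogRegSol pc M4.qc 1 (14 / 5)) 0 :=
    ((isScalarLogData.logRegSol 1 (14 / 5)).2 0 (by simpa using isScalarLogData.radius_pos)).1
  have hs : HasDerivAt (fun x => ((scalarSmallSol pc M4.qc) x).1) ((deriv (scalarSmallSol pc M4.qc) 0).1) 0 :=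
    (ContinuousLinearMap.fst ℝ ℝ ℝ).hasFDerivAt.comp_hasDerivAt 0 hSd.hasDerivAt
  have hs' : HasDerivAt (fun x => ((scalarSmallSol pc M4.qc) x).2) ((deriv (scalarSmallSol pc M4.qc) 0).2) 0 :=
    (ContinuousLinearMap.snd ℝ ℝ ℝ).hasFDerivAt.comp_hasDerivAt 0 hSd.hasDerivAt
  have hη : ContinuousAt (fun x => ((scalarLogRegSol pc M4.qc 1 (14 / 5)) x).1) 0 :=
    ((ContinuousLinearMap.fst ℝ ℝ ℝ).hasFDerivAt.comp_hasDerivAt 0 hEd.hasDerivAt).continuousAt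
  have hζ : ContinuousAt (fun x => ((scalarLogRegSol pc M4.qc 1 (14 / 5)) x).2) 0 :=
    ((ContinuousLinearMap.snd ℝ ℝ ℝ).hasFDerivAt.comp_hasDerivAt 0 hEd.hasDerivAt).continuousAt
  have hs0 : ((scalarSmallSol pc M4.qc) 0).1 = 0 := by rw [small_zero]
  have hs'0 : ((scalarSmallSol pc M4.qc) 0).2 = 1 := by rw [small_zero]
  have hη0 : ((scalarLogRegSol pc M4.qc 1 (14 / 5)) 0).1 = 1 := by rw [reg_zero]
  have hA : (1 : ℝ) * ((scalarLogRegSol pc M4.qc 1 (14 / 5)) 0).1 ≠ 0 := by rw [hη0]; norm_num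
  have hψ0 : ψ 1 = 1 * ((scalarLogRegSol pc M4.qc 1 (14 / 5)) 0).1 := by rw [hη0, hψ1]; norm_num
  have key := Tearing.isDeltaPrime_of_logBranch (ψ := ψ) (ψ' := ψ') (rs := 1) (κ := 14 / 5) (A := 1) (Bp := bR)
    (Bm := bL) hδ0 hs0 hs hs' hη hζ hA hψ0 ?_ ?_ ?_ ?_
  · have e : (bR - bL) * ((scalarSmallSol pc M4.qc) 0).2 / (1 * ((scalarLogRegSol pc M4.qc 1 (14 / 5)) 0).1) = bR - bL := by rw [hs'0, hη0]; norm_num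
    rwa [e] at key
  · intro x hx
    have hu : 1 + x ∈ Ioo 1 (1 + δ) := ⟨by linarith [hx.1], by linarith [hx.2]⟩
    rw [(hψr _ hu).1, (reprR x hx).1, log_fst]; ring
  · intro x hx
    have hu : 1 + x ∈ Ioo (1 - δ) 1 := ⟨by linarith [hx.1], by linarith [hx.2]⟩
    rw [(hψl _ hu).1, (reprL x hx).1, log_fst]; ring
  · intro x hx
    have hu : 1 + x ∈ Ioo 1 (1 + δ) := ⟨by linarith [hx.1], by linarith [hx.2]⟩
    rw [(hψr _ hu).2, (reprR x hx).2, log_snd]; ring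
  · intro x hx
    have hu : 1 + x ∈ Ioo (1 - δ) 1 := ⟨by linarith [hx.1], by linarith [hx.2]⟩
    rw [(hψl _ hu).2, (reprL x hx).2, log_snd]; ring

/-- Scaling an outer solution by a constant gives an outer solution (linearity of MODEL M's equation). [instance data] -/
theorem IsScaledOuterSolution.smul {L L' : ℝ → ℝ} {s : Set ℝ} (hL : M4.IsScaledOuterSolution L L' s) (c : ℝ) :
    M4.IsScaledOuterSolution (fun u => c * L u) (fun u => c * L' u) s := by
  intro u hu
  obtain ⟨h1, h2⟩ := hL u hu
  refine ⟨h1.const_mul c, (h2.const_mul c).congr_deriv ?_⟩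
  ring

end Patch

end M4

end TearingFRS1

end Summit.Ventures.FusionMHD.Models

end
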